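import Summits.AtomisticToContinuum.Crystallization.Theorems.PricedLinkCensusTruncatedCensusGapHarmonicZModTorus

/-!
# Crux `PricedLinkCensus.TruncatedCensusGap` (stmt-AtomisticToContinuum-14230), line `near-far-split`,
# stub N2 `stub_harmonicCoercivityWindow`: the certificate interface — positivity on the unit torus

The user-facing form of the generic half of N2's certified core.  A finite-range block kernel
`K : ℤᵏ → ℝ^{ι×ι}` (supported in a finite `R`) has the matrix Laurent polynomial ("Bloch / LMI
matrix") `M(ζ) = Σ_{d ∈ R} (∏_l ζ_l^{d_l}) K d` on the unit torus `|ζ_l| = 1`.  **If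
`Re vᴴ M(ζ) v ≥ 0` for every `ζ` on the unit torus and every complex `v`, then the lattice form
`Σ_{x,y ∈ S} u(x)ᵀ K(x - y) u(y)` is `≥ 0` for EVERY finite `S` and every field `u`**
(`latticeForm_nonneg_of_unitTorusSymbol`): embed `S` in a discrete torus `(ℤ/L)ᵏ` with `L`
larger than all `|x_l - y_l - d_l|` (`latticeForm_nonneg_of_zmodSymbol`) and note that every
character of `(ℤ/L)ᵏ` pulled back to `ℤᵏ` is `d ↦ ∏_l ζ_l^{d_l}` with `ζ_l = ψ(e_l)` of norm `1`
(`addChar_castZMod_eq_prod_zpow`).  So a certificate only ever has to bound a matrix trigonometric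
polynomial on the torus — for N2, the 9×9 transfer LMIs (or the `3p×3p` Bloch matrices) on
`T² × window` (resp. `T³ × window`).  All `[folklore]`, `def`-free.
-/

noncomputable section

namespace Summit.AtomisticToContinuum.Crystallization.Theorems.PricedLinkCensusTruncatedCensusGap

open scoped BigOperators
open Finset

/-- An additive character turns finite sums into finite products. [folklore] -/
theorem addChar_apply_finset_sum {A M ι' : Type*} [AddCommMonoid A] [CommMonoid M]
    (ψ : AddChar A M) (s : Finset ι') (f : ι' → A) :
    ψ (∑ i ∈ s, f i) = ∏ i ∈ s, ψ (f i) := by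
  classical
  induction s using Finset.induction_on with
  | empty => simp
  | insert a s ha ih => rw [Finset.sum_insert ha, Finset.prod_insert ha, AddChar.map_add_eq_mul, ih]

/-- **Characters of `(ℤ/L)ᵏ` pulled back to `ℤᵏ` are monomials**: with `ζ_l = ψ(e_l)`,
`ψ(d mod L) = ∏_l ζ_l ^ d_l`. [folklore] -/
theorem addChar_castZMod_eq_prod_zpow {k L : ℕ} (ψ : AddChar (Fin k → ZMod L) ℂ)
    (d : Fin k → ℤ) :
    ψ (fun l => ((d l : ℤ) : ZMod L)) = ∏ l, ψ (Pi.single l 1) ^ (d l) := by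
  have hd : (fun l => ((d l : ℤ) : ZMod L)) = ∑ l, (d l) • Pi.single l (1 : ZMod L) := by
    conv_lhs => rw [← Finset.univ_sum_single (fun l => ((d l : ℤ) : ZMod L))]
    refine Finset.sum_congr rfl fun l _ => ?_
    rw [← Pi.single_smul, Int.smul_one_eq_cast]
  rw [hd, addChar_apply_finset_sum]
  refine Finset.prod_congr rfl fun l _ => ?_
  rw [AddChar.map_zsmul_eq_zpow]

/-- The values `ζ_l = ψ(e_l)` lie on the unit circle (`L ≠ 0`). [folklore] -/
theorem norm_addChar_single {k L : ℕ} [NeZero L] (ψ : AddChar (Fin k → ZMod L) ℂ) (l : Fin k) :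
    ‖ψ (Pi.single l 1)‖ = 1 :=
  AddChar.norm_apply ψ _

/-- A box containing all differences `x - y - d`, `x, y ∈ S`, `d ∈ R`: with
`B = 2 Σ_{x ∈ S} Σ_l |x_l| + Σ_{d ∈ R} Σ_l |d_l|`, `|x_l - y_l - d_l| ≤ B`. [folklore] -/
theorem abs_sub_sub_le_box {k : ℕ} (S R : Finset (Fin k → ℤ)) {x y d : Fin k → ℤ} (hx : x ∈ S)
    (hy : y ∈ S) (hd : d ∈ R) (l : Fin k) :
    |x l - y l - d l| ≤ 2 * (∑ z ∈ S, ∑ i, |z i|) + ∑ e ∈ R, ∑ i, |e i| := by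
  have h1 : ∀ z ∈ S, |z l| ≤ ∑ z ∈ S, ∑ i, |z i| := by
    intro z hz
    calc |z l| ≤ ∑ i, |z i| :=
          Finset.single_le_sum (f := fun i => |z i|) (fun i _ => abs_nonneg _) (Finset.mem_univ l)
      _ ≤ ∑ z ∈ S, ∑ i, |z i| :=
          Finset.single_le_sum (f := fun z => ∑ i, |z i|)
            (fun z _ => Finset.sum_nonneg fun i _ => abs_nonneg _) hz
  have h2 : |d l| ≤ ∑ e ∈ R, ∑ i, |e i| := by
    calc |d l| ≤ ∑ i, |d i| :=
          Finset.single_le_sum (f := fun i => |d i|) (fun i _ => abs_nonneg _) (Finset.mem_univ l)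
      _ ≤ ∑ e ∈ R, ∑ i, |e i| :=
          Finset.single_le_sum (f := fun e => ∑ i, |e i|)
            (fun e _ => Finset.sum_nonneg fun i _ => abs_nonneg _) hd
  have hxl := h1 x hx
  have hyl := h1 y hy
  calc |x l - y l - d l| ≤ |x l - y l| + |d l| := abs_sub _ _
    _ ≤ |x l| + |y l| + |d l| := by linarith [abs_sub (x l) (y l)]
    _ ≤ _ := by linarith

/-- **Lattice form ≥ 0 from positivity of the Bloch/LMI matrix on the unit torus — the certificate
interface of N2.**  Let `K : ℤᵏ → ℝ^{ι×ι}` vanish off the finite set `R`.  If for every `ζ` on the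
unit torus (`‖ζ_l‖ = 1`) and every complex vector `v`,
`Re vᴴ (Σ_{d ∈ R} (∏_l ζ_l^{d_l}) K d) v ≥ 0`, then for every finite `S ⊆ ℤᵏ` and every field
`u`, `Σ_{x,y ∈ S} u(x)ᵀ K(x - y) u(y) ≥ 0`. [folklore] -/
theorem latticeForm_nonneg_of_unitTorusSymbol :
    ∀ {ι : Type} [Fintype ι] (k : ℕ) (R : Finset (Fin k → ℤ)) (K : (Fin k → ℤ) → Matrix ι ι ℝ), (∀ d, d ∉ R → K d = 0) → (∀ (ζ : Fin k → ℂ) (v : ι → ℂ), (∀ l, ‖ζ l‖ = 1) → 0 ≤ (star v ⬝ᵥ (∑ d ∈ R, (∏ l, ζ l ^ (d l)) • (K d).map ((↑) : ℝ → ℂ)).mulVec v).re) → ∀ (S : Finset (Fin k → ℤ)) (u : (Fin k → ℤ) → ι → ℝ), 0 ≤ ∑ x ∈ S, ∑ y ∈ S, u x ⬝ᵥ (K (x - y)).mulVec (u y) := by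
  intro ι _ k R K hK hpos S u
  -- a torus large enough
  set B : ℤ := 2 * (∑ z ∈ S, ∑ i, |z i|) + ∑ e ∈ R, ∑ i, |e i| with hB
  set L : ℕ := B.toNat + 1 with hL
  haveI : NeZero L := ⟨by omega⟩
  have hbox : ∀ x ∈ S, ∀ y ∈ S, ∀ d ∈ R, ∀ l, |x l - y l - d l| < L := by
    intro x hx y hy d hd l
    have h := abs_sub_sub_le_box S R hx hy hd l
    have hBL : B < (L : ℤ) := by
      rw [hL]; push_cast; omega
    exact lt_of_le_of_lt h hBL
  refine latticeForm_nonneg_of_zmodSymbol k L S R u K hK hbox ?_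
  intro ψ v
  have key : ∀ d : Fin k → ℤ, ψ (fun l => ((d l : ℤ) : ZMod L)) = ∏ l, ψ (Pi.single l 1) ^ (d l) :=
    fun d => addChar_castZMod_eq_prod_zpow ψ d
  simp_rw [key]
  exact hpos (fun l => ψ (Pi.single l 1)) v (fun l => norm_addChar_single ψ l)

end Summit.AtomisticToContinuum.Crystallization.Theorems.PricedLinkCensusTruncatedCensusGap

end
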